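import Summits.Parity.BatemanHorn.Theses.IsogenyRedei

/-!
# Disproof of `QuadraticOmegaParity` (stmt-Parity-11585) — standing adversary's work file

Crux (route `IsogenyRedei`, rank 4; decl
`Summit.Parity.BatemanHorn.Theses.IsogenyRedei.QuadraticOmegaParity`):

  ∀ f : ℤ[X], Irreducible f → f.natDegree = 2 → 0 < f.leadingCoeff → ∀ q a : ℕ, 0 < q →
    (x ↦ Σ_{n ∈ [1,x], n ≡ a (mod q)} (−1)^{ω((f n).toNat)}) =o[atTop] (x ↦ x)

i.e. the parity of the number of distinct prime factors of the values of an irreducible integer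
quadratic is equidistributed along every arithmetic progression (polynomial Chowla, ω-form,
degree 2, in APs).

## Findings (cycle 1) — the crux RESISTS; no refutation exists by cheap means

* §0 `S`, `Concl`, `quadraticOmegaParity_iff` — normal form of the crux (definitional).
* §1 LOAD-BEARING ANALYSIS (one `Without…` statement per hypothesis):
  - `quadraticOmegaParity_false_without_posLead` — dropping `0 < f.leadingCoeff` is FALSE, but only
    through the `Int.toNat` encoding: for `f = −(X²+X+1)` every value is negative, `toNat = 0`,
    `ω 0 = 0`, every term is `+1` and the sum is `x`. (The natAbs-reading of a negative-lead
    quadratic is the same open statement; the hypothesis is an encoding guard, not arithmetic.)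
  - `quadraticOmegaParity_false_without_degree` — dropping `f.natDegree = 2` is FALSE: the constant
    `f = C 2` is irreducible in `ℤ[X]` (2 is prime in `ℤ[X]`) with positive leading coefficient and
    `(−1)^{ω(2)} = −1` for every `n`, so the sum is `−x`. Degree 1 instead of 2 is a THEOREM in
    print (Halász/Delange for the completely determined multiplicative `(−1)^ω` twisted by Dirichlet
    characters) — not refutable; degree ≥ 3 is open like degree 2.
  - `quadraticOmegaParity_iff_withoutQPos` — `0 < q` is NOT load-bearing: for `q = 0` the
    progression `{n ≡ a (mod 0)} = {a}` has at most one term (`concl_modulus_zero`).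
  - `Irreducible f`: SCOPE, not load-bearing for truth — `of_withoutIrreducible` records the trivial
    direction; no reducible quadratic with a provably biased ω-parity exists: `(aX+b)²` gives the
    linear case (theorem), `(aX+b)(cX+d)` is binary Chowla for `(−1)^ω` (open, believed), and an
    imprimitive `c·g` only shifts `ω` by a quantity periodic in `n` (see §4(iii)).
* §2 NON-VACUITY and the TRIVIAL BOUND: `hypotheses_inhabited` (`X²+X+1 = Φ₃`), `abs_S_le_card`,
  `sum_abs_eq_card` — `|S| ≤ #AP ≤ x` with equality for the absolute values, so the crux asks for
  genuine cancellation and nothing weaker than `o(#AP)` is at stake.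
* §3 REFUTED STRENGTHENINGS: `not_quadraticOmegaParityUniformInF` — the version uniform in the
  polynomial (`∀ ε, ∃ x₀, ∀ x ≥ x₀, ∀ f …, |S_f(x;1,0)| ≤ ε x`) is FALSE, again via the encoding:
  for a prime `p > x²`, `f = X² − p` is Eisenstein-irreducible (`irreducible_X_sq_sub_prime`), monic,
  and negative on `[1,x]`, so `S_f(x;1,0) = x`. (Any f-uniformity a planner may want must carry
  `x ≥ x₀(f)` or use `natAbs`; with `natAbs` f-uniformity is still not to be expected — prime-rich
  quadratics `X²+X+41` give `S(40) = −40` — but that is not a theorem for all `x`.)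
  `not_quadraticOmegaParityUniformInQ` — the naive modulus-uniform shape `|S| ≤ ε x/q ∀ q` is false
  (one-term progressions, `abs_S_self_modulus`); any level-uniform variant needs `+O(1)` / `q ≤ x^{1−δ}`.
* §3b THE SIGN HYPOTHESIS IS AN ENCODING ARTEFACT: `quadraticOmegaParity_iff_abs` — the crux is
  EQUIVALENT to its `natAbs`-encoded form with NO leading-coefficient condition
  (`QuadraticOmegaParityAbs`); ingredients `eval_pos_of_le` (a quadratic with `lc > 0` is positive
  at every `n ≥ |c₀|+|c₁|+1`), `abs_S_sub_Sabs_le` (the two encodings differ by `≤ 2B(f)` uniformly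
  in `q, a, x`), `isLittleO_of_abs_sub_le`. Provers may work in either encoding.
* §3c CONTENT: `quadraticOmegaParity_iff_withContent` — the crux is EQUIVALENT to its extension to
  all `ℚ`-irreducible integer quadratics `c·h` (`c ≥ 1`, `h` primitive irreducible) along all
  progressions: `(−1)^{ω(c·h(n))} = ε_b·(−1)^{ω(h(n))}` with `ε_b` constant on classes mod `q·c`
  (`term_content_mul`, polynomial congruence `dvd_eval_iff_of_modEq`), fiber decomposition
  `S_eq_sum_fibers`. So imprimitive quadratics are no counterexample reservoir, and `Irreducible`
  (which forces content 1) is pure scope — formal content of the §1 remark and half of §4(iii).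
* §3d APs ⟺ CONTENT: `quadraticOmegaParity_iff_contentQ1` — the crux is EQUIVALENT to the `q = 1`
  statement over all `ℚ`-irreducible integer quadratics `c·h`: the substitution `n = q·m + a₀`
  (`abs_S_sub_S_dilate_le`, one boundary term) turns the progression into the full sum for the dilated
  `g = f(qX + a₀) = content · primPart` (`dilate_eq_content_mul`: Gauss's lemma both ways + "no
  rational roots" for degree 2, `roots_comp_linear_eq_zero`). THE PROGRESSION QUANTIFIER CARRIES NO
  DIFFICULTY BEYOND CONTENT; a refuter may hunt at `q = 1` among imprimitive quadratics, a prover may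
  drop `q, a` at the price of content. CLEANEST NORMAL FORM: `quadraticOmegaParity_iff_rat` —
  crux ⟺ `QuadraticOmegaParityRat := ∀ g : ℤ[X], Irreducible (g.map ℚ) → g.natDegree = 2 →
  0 < g.leadingCoeff → Σ_{m ≤ x} (−1)^{ω(g(m))} = o(x)` (Chowla's conjecture, `ω`-form, for every
  `ℚ`-irreducible integer quadratic; `eq_content_mul_of_irreducible_map`, `irreducible_map_C_mul`).
* §4 WHY IT RESISTS (prose, with the computations and searches behind it) — see the end of file.

No `sorry` in this file. Everything here is `lean check` rc 0 with axioms
`{propext, Classical.choice, Quot.sound}`.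
-/

namespace Summit.Parity.BatemanHorn.Cruxes.QuadraticOmegaParity.Disproof

open Polynomial Filter Asymptotics Finset
open Summit.Parity.BatemanHorn.Theses.IsogenyRedei (QuadraticOmegaParity)

/-! ## §0 Normal form -/

/-- The AP parity sum of the crux: `S f q a x = Σ_{n ∈ [1,x], n ≡ a (mod q)} (−1)^{ω((f n).toNat)}`. -/
noncomputable def S (f : ℤ[X]) (q a x : ℕ) : ℝ :=
  ∑ n ∈ (Finset.Icc 1 x).filter (fun n : ℕ => n ≡ a [MOD q]),
    (-1 : ℝ) ^ ArithmeticFunction.cardDistinctFactors ((f.eval (n : ℤ)).toNat)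

/-- The conclusion of the crux for one triple `(f, q, a)`: `S f q a = o(x)`. -/
def Concl (f : ℤ[X]) (q a : ℕ) : Prop :=
  (fun x : ℕ => S f q a x) =o[atTop] fun x : ℕ => (x : ℝ)

/-- The crux in normal form (definitional unfolding). -/
theorem quadraticOmegaParity_iff :
    QuadraticOmegaParity ↔
      ∀ f : ℤ[X], Irreducible f → f.natDegree = 2 → 0 < f.leadingCoeff →
        ∀ q a : ℕ, 0 < q → Concl f q a :=
  Iff.rfl

/-- The term of the sum has absolute value one. -/
theorem abs_term (m : ℕ) :
    |(-1 : ℝ) ^ ArithmeticFunction.cardDistinctFactors m| = 1 := by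
  rw [abs_pow, abs_neg, abs_one, one_pow]

/-- At modulus `q = 1` the progression is all of `[1, x]`. -/
theorem filter_modEq_one (x a : ℕ) :
    (Finset.Icc 1 x).filter (fun n : ℕ => n ≡ a [MOD 1]) = Finset.Icc 1 x :=
  Finset.filter_true_of_mem fun _ _ => Nat.modEq_one

/-- A real sequence bounded below by `δ·x` (`δ > 0`) in absolute value is not `o(x)`. -/
theorem not_isLittleO_of_linear_lower_bound {g : ℕ → ℝ} {δ : ℝ} (hδ : 0 < δ) (N : ℕ)
    (hg : ∀ x : ℕ, N ≤ x → δ * x ≤ |g x|) : ¬ (g =o[atTop] fun x : ℕ => (x : ℝ)) := by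
  intro h
  have h1 := h.def (half_pos hδ)
  obtain ⟨x, ⟨hxN, hx1⟩, hx2⟩ :=
    (((eventually_ge_atTop N).and (eventually_ge_atTop 1)).and h1).exists
  have hx := hg x hxN
  rw [Real.norm_eq_abs, Real.norm_natCast] at hx2
  have hx1' : (1 : ℝ) ≤ x := by exact_mod_cast hx1
  have h3 : δ * x ≤ δ / 2 * x := hx.trans hx2
  nlinarith

/-! ## §1 Load-bearing analysis -/

/-- The crux with `0 < f.leadingCoeff` dropped. -/
def QuadraticOmegaParityWithoutPosLead : Prop :=
  ∀ f : ℤ[X], Irreducible f → f.natDegree = 2 → ∀ q a : ℕ, 0 < q → Concl f q a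

/-- The witness polynomial `−(X² + X + 1) = −Φ₃`. -/
theorem irreducible_neg_cyclotomic_three : Irreducible (-(cyclotomic 3 ℤ)) :=
  ((Associated.refl (cyclotomic 3 ℤ)).neg_right).irreducible
    (cyclotomic.irreducible (by norm_num))

theorem natDegree_neg_cyclotomic_three : (-(cyclotomic 3 ℤ)).natDegree = 2 := by
  rw [natDegree_neg, natDegree_cyclotomic, Nat.totient_prime Nat.prime_three]

/-- Every value of `−Φ₃` at a natural number is negative, so `toNat` sends it to `0`. -/
theorem eval_neg_cyclotomic_three_toNat (n : ℕ) :
    ((-(cyclotomic 3 ℤ)).eval (n : ℤ)).toNat = 0 := by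
  rw [Int.toNat_eq_zero, eval_neg, cyclotomic_three]
  simp only [eval_add, eval_pow, eval_X, eval_one]
  nlinarith [sq_nonneg (n : ℤ)]

/-- For `f = −Φ₃`, `q = 1`: every term is `(−1)^{ω 0} = 1`, so the sum is `x`. -/
theorem S_neg_cyclotomic_three (x : ℕ) : S (-(cyclotomic 3 ℤ)) 1 0 x = x := by
  unfold S
  rw [filter_modEq_one]
  simp only [eval_neg_cyclotomic_three_toNat, ArithmeticFunction.map_zero, pow_zero,
    sum_const, Nat.card_Icc, nsmul_eq_mul, mul_one]
  push_cast
  ring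

/-- **Any proof must use `0 < f.leadingCoeff`** (through the `toNat` encoding):
with it dropped, `f = −(X²+X+1)`, `q = 1`, `a = 0` gives the sum `x`, which is not `o(x)`. -/
theorem quadraticOmegaParity_false_without_posLead : ¬ QuadraticOmegaParityWithoutPosLead := by
  intro h
  have hc := h _ irreducible_neg_cyclotomic_three natDegree_neg_cyclotomic_three 1 0 one_pos
  refine not_isLittleO_of_linear_lower_bound one_pos 0 (fun x _ => ?_) hc
  rw [S_neg_cyclotomic_three, one_mul, Nat.abs_cast]

/-- The crux with `f.natDegree = 2` dropped. -/
def QuadraticOmegaParityWithoutDegree : Prop :=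
  ∀ f : ℤ[X], Irreducible f → 0 < f.leadingCoeff → ∀ q a : ℕ, 0 < q → Concl f q a

/-- `2` is prime, hence irreducible, in `ℤ[X]`. -/
theorem irreducible_C_two : Irreducible (C (2 : ℤ)) :=
  (prime_C_iff.mpr Int.prime_two).irreducible

/-- For the constant `f = 2`, `q = 1`: every term is `(−1)^{ω 2} = −1`, so the sum is `−x`. -/
theorem S_C_two (x : ℕ) : S (C (2 : ℤ)) 1 0 x = -x := by
  unfold S
  rw [filter_modEq_one]
  have h2 : ((2 : ℤ)).toNat = 2 := rfl
  simp only [eval_C, h2, ArithmeticFunction.cardDistinctFactors_apply_prime Nat.prime_two,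
    pow_one, sum_const, Nat.card_Icc, nsmul_eq_mul, mul_neg, mul_one]
  push_cast
  ring

/-- **Any proof must use `f.natDegree = 2`** (at least to exclude constants): with it dropped,
the irreducible constant `f = C 2` (positive leading coefficient `2`) gives the sum `−x`. -/
theorem quadraticOmegaParity_false_without_degree : ¬ QuadraticOmegaParityWithoutDegree := by
  intro h
  have hc := h _ irreducible_C_two (by rw [leadingCoeff_C]; norm_num) 1 0 one_pos
  refine not_isLittleO_of_linear_lower_bound one_pos 0 (fun x _ => ?_) hc
  rw [S_C_two, abs_neg, one_mul, Nat.abs_cast]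

/-- The crux with `0 < q` dropped. -/
def QuadraticOmegaParityWithoutQPos : Prop :=
  ∀ f : ℤ[X], Irreducible f → f.natDegree = 2 → 0 < f.leadingCoeff → ∀ q a : ℕ, Concl f q a

/-- `|S| ≤ #AP`: the trivial bound. -/
theorem abs_S_le_card (f : ℤ[X]) (q a x : ℕ) :
    |S f q a x| ≤ ((Finset.Icc 1 x).filter (fun n : ℕ => n ≡ a [MOD q])).card := by
  unfold S
  refine (Finset.abs_sum_le_sum_abs _ _).trans ?_
  simp only [abs_term, sum_const, nsmul_eq_mul, mul_one, le_refl]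

/-- Modulus `0`: the progression `{n ≡ a (mod 0)} = {a}` has at most one term, so `S = O(1) = o(x)`. -/
theorem concl_modulus_zero (f : ℤ[X]) (a : ℕ) : Concl f 0 a := by
  have hb : ∀ x, |S f 0 a x| ≤ 1 := by
    intro x
    refine (abs_S_le_card f 0 a x).trans ?_
    have hsub : (Finset.Icc 1 x).filter (fun n : ℕ => n ≡ a [MOD 0]) ⊆ {a} := by
      intro n hn
      rw [Finset.mem_filter, Nat.modEq_zero_iff] at hn
      rw [Finset.mem_singleton]
      exact hn.2
    exact_mod_cast (Finset.card_le_card hsub).trans (Finset.card_singleton a).le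
  have h1 : (fun x : ℕ => S f 0 a x) =O[atTop] (fun _ : ℕ => (1 : ℝ)) :=
    IsBigO.of_bound 1 (Eventually.of_forall fun x => by
      simpa only [Real.norm_eq_abs, abs_one, mul_one] using hb x)
  have h2 : (fun _ : ℕ => (1 : ℝ)) =o[atTop] (fun x : ℕ => (x : ℝ)) := by
    rw [Asymptotics.isLittleO_one_left_iff]
    simpa only [Real.norm_natCast] using tendsto_natCast_atTop_atTop
  exact h1.trans_isLittleO h2

/-- **`0 < q` is not load-bearing**: the crux is equivalent to its version over all `q : ℕ`. -/
theorem quadraticOmegaParity_iff_withoutQPos :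
    QuadraticOmegaParity ↔ QuadraticOmegaParityWithoutQPos := by
  refine ⟨fun h f hf hd hl q a => ?_, fun h f hf hd hl q a _ => h f hf hd hl q a⟩
  rcases Nat.eq_zero_or_pos q with rfl | hq
  · exact concl_modulus_zero f a
  · exact h f hf hd hl q a hq

/-- The crux with `Irreducible f` dropped (all integer quadratics with positive leading
coefficient, reducible and imprimitive ones included). -/
def QuadraticOmegaParityWithoutIrreducible : Prop :=
  ∀ f : ℤ[X], f.natDegree = 2 → 0 < f.leadingCoeff → ∀ q a : ℕ, 0 < q → Concl f q a

/-- `Irreducible` only narrows the scope: the version without it implies the crux. No refutation of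
the wider version is available — its extra instances are theorems (`(aX+b)²`: the linear case) or
open and believed (`(aX+b)(cX+d)`: binary Chowla for `(−1)^ω`; imprimitive `c·g`: §4(iii)). -/
theorem of_withoutIrreducible (h : QuadraticOmegaParityWithoutIrreducible) :
    QuadraticOmegaParity :=
  fun f _ hd hl q a hq => h f hd hl q a hq

/-! ## §2 Non-vacuity and the trivial bound -/

/-- The hypotheses of the crux are satisfiable: `Φ₃ = X² + X + 1`. -/
theorem hypotheses_inhabited :
    ∃ f : ℤ[X], Irreducible f ∧ f.natDegree = 2 ∧ 0 < f.leadingCoeff :=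
  ⟨cyclotomic 3 ℤ, cyclotomic.irreducible (by norm_num),
    by rw [natDegree_cyclotomic, Nat.totient_prime Nat.prime_three],
    by rw [(cyclotomic.monic 3 ℤ).leadingCoeff]; exact one_pos⟩

/-- The trivial bound is attained by the absolute values: `Σ |term| = #AP`. -/
theorem sum_abs_eq_card (f : ℤ[X]) (q a x : ℕ) :
    ∑ n ∈ (Finset.Icc 1 x).filter (fun n : ℕ => n ≡ a [MOD q]),
        |(-1 : ℝ) ^ ArithmeticFunction.cardDistinctFactors ((f.eval (n : ℤ)).toNat)|
      = ((Finset.Icc 1 x).filter (fun n : ℕ => n ≡ a [MOD q])).card := by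
  simp only [abs_term, sum_const, nsmul_eq_mul, mul_one]

/-- `|S f q a x| ≤ x`. -/
theorem abs_S_le (f : ℤ[X]) (q a x : ℕ) : |S f q a x| ≤ x := by
  refine (abs_S_le_card f q a x).trans ?_
  have : ((Finset.Icc 1 x).filter (fun n : ℕ => n ≡ a [MOD q])).card ≤ x := by
    refine (Finset.card_filter_le _ _).trans ?_
    rw [Nat.card_Icc]; omega
  exact_mod_cast this

/-! ## §3 Refuted strengthenings -/

/-- `X² − p` is irreducible in `ℤ[X]` for a prime `p` (Eisenstein at `p`). -/
theorem irreducible_X_sq_sub_prime {p : ℕ} (hp : p.Prime) :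
    Irreducible (X ^ 2 - C (p : ℤ) : ℤ[X]) := by
  set P : Ideal ℤ := Ideal.span {(p : ℤ)} with hP
  have hPprime : P.IsPrime :=
    Ideal.isPrime_span_singleton_of_prime (Nat.prime_iff_prime_int.1 hp)
  have hmonic : (X ^ 2 - C (p : ℤ) : ℤ[X]).Monic := monic_X_pow_sub_C _ two_ne_zero
  have hdeg : (X ^ 2 - C (p : ℤ) : ℤ[X]).natDegree = 2 := natDegree_X_pow_sub_C
  have hp1 := hp.two_le
  have hE : (X ^ 2 - C (p : ℤ) : ℤ[X]).IsEisensteinAt P := by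
    refine ⟨?_, ?_, ?_⟩
    · rw [hmonic.leadingCoeff, hP, Ideal.mem_span_singleton]
      intro h
      have : (p : ℤ) ≤ 1 := Int.le_of_dvd one_pos h
      omega
    · intro k hk
      rw [hdeg] at hk
      rw [coeff_sub, coeff_X_pow, coeff_C, if_neg hk.ne, zero_sub, hP, Ideal.mem_span_singleton]
      split_ifs
      · exact dvd_neg.mpr dvd_rfl
      · rw [neg_zero]; exact dvd_zero _
    · rw [coeff_sub, coeff_X_pow, coeff_C, if_neg (by omega : (0 : ℕ) ≠ 2), zero_sub, if_pos rfl,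
        hP, Ideal.span_singleton_pow, Ideal.mem_span_singleton, dvd_neg]
      intro h
      have h1 : ((p : ℤ)) ^ 2 ≤ p := Int.le_of_dvd (by exact_mod_cast hp.pos) h
      nlinarith
  exact hE.irreducible hPprime hmonic.isPrimitive (by rw [hdeg]; omega)

/-- For `p > x²`, every value `n² − p`, `1 ≤ n ≤ x`, is negative: the sum `S_{X²−p}(x;1,0)` is `x`. -/
theorem S_X_sq_sub_prime {p x : ℕ} (hpx : x ^ 2 < p) : S (X ^ 2 - C (p : ℤ)) 1 0 x = x := by
  unfold S
  rw [filter_modEq_one]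
  have hterm : ∀ n ∈ Finset.Icc 1 x,
      (-1 : ℝ) ^ ArithmeticFunction.cardDistinctFactors
        (((X ^ 2 - C (p : ℤ) : ℤ[X]).eval (n : ℤ)).toNat) = 1 := by
    intro n hn
    rw [Finset.mem_Icc] at hn
    have hnx : n ^ 2 ≤ x ^ 2 := Nat.pow_le_pow_left hn.2 2
    have h0 : (((X ^ 2 - C (p : ℤ) : ℤ[X]).eval (n : ℤ)).toNat) = 0 := by
      rw [Int.toNat_eq_zero, eval_sub, eval_pow, eval_X, eval_C]
      have : ((n : ℤ)) ^ 2 < p := by exact_mod_cast hnx.trans_lt hpx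
      linarith
    rw [h0, ArithmeticFunction.map_zero, pow_zero]
  rw [Finset.sum_congr rfl hterm]
  simp only [sum_const, Nat.card_Icc, nsmul_eq_mul, mul_one]
  push_cast
  ring

/-- The crux made UNIFORM IN THE POLYNOMIAL: one threshold `x₀(ε)` for all irreducible quadratics. -/
def QuadraticOmegaParityUniformInF : Prop :=
  ∀ ε : ℝ, 0 < ε → ∃ x₀ : ℕ, ∀ x : ℕ, x₀ ≤ x →
    ∀ f : ℤ[X], Irreducible f → f.natDegree = 2 → 0 < f.leadingCoeff → |S f 1 0 x| ≤ ε * x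

/-- **Refuted strengthening (uniformity in `f`)**: given any `x`, the Eisenstein quadratic
`f = X² − p` with a prime `p > x²` is irreducible, monic, and negative on `[1, x]`, so by the
`toNat` encoding `S_f(x;1,0) = x`: no threshold uniform in `f` exists. (Encoding-driven; with
`natAbs` uniformity in `f` is not expected either — `X² + X + 41` has `S(40) = −40` — but no proof
for all `x` is available, prime-producing quadratics of every length being hypothetical.) -/
theorem not_quadraticOmegaParityUniformInF : ¬ QuadraticOmegaParityUniformInF := by
  intro h
  obtain ⟨x₀, hx₀⟩ := h (1 / 2) one_half_pos
  obtain ⟨p, hpx, hp⟩ := Nat.exists_infinite_primes ((max x₀ 1) ^ 2 + 1)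
  have hlt : (max x₀ 1) ^ 2 < p := hpx
  have hS := hx₀ (max x₀ 1) (le_max_left _ _) (X ^ 2 - C (p : ℤ)) (irreducible_X_sq_sub_prime hp)
    natDegree_X_pow_sub_C (by rw [(monic_X_pow_sub_C (p : ℤ) two_ne_zero).leadingCoeff]; norm_num)
  rw [S_X_sq_sub_prime hlt, Nat.abs_cast] at hS
  have h1 : (1 : ℝ) ≤ ((max x₀ 1 : ℕ) : ℝ) := by exact_mod_cast le_max_right x₀ 1
  linarith

/-- The crux made UNIFORM IN THE MODULUS with the naive normalisation `ε·x/q`: false for the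
trivial reason that a progression with one term has `|S| = 1` (take `q = x`). Recorded only to pin
the right shape of any level-uniform variant (it must allow `+O(1)` or restrict `q ≤ x^{1−δ}`);
the route's squarefree sieve (`OmegaToMobiusAP`) needs moduli `q·r²`, `r → ∞` slowly, which the
fixed-`R` diagonal argument supplies from the pointwise crux — no uniformity is actually required. -/
def QuadraticOmegaParityUniformInQ : Prop :=
  ∀ f : ℤ[X], Irreducible f → f.natDegree = 2 → 0 < f.leadingCoeff →
    ∀ ε : ℝ, 0 < ε → ∃ x₀ : ℕ, ∀ x : ℕ, x₀ ≤ x → ∀ q a : ℕ, 0 < q → |S f q a x| ≤ ε * x / q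

/-- The one-term progression: for `1 ≤ x`, `S f x 0 x = ±1` (the only `n ∈ [1,x]` with `x ∣ n` is `x`). -/
theorem abs_S_self_modulus (f : ℤ[X]) {x : ℕ} (hx : 1 ≤ x) : |S f x 0 x| = 1 := by
  unfold S
  have hfil : (Finset.Icc 1 x).filter (fun n : ℕ => n ≡ 0 [MOD x]) = {x} := by
    ext n
    simp only [Finset.mem_filter, Finset.mem_Icc, Finset.mem_singleton, Nat.modEq_zero_iff_dvd]
    constructor
    · rintro ⟨⟨h1, h2⟩, h3⟩
      exact le_antisymm h2 (Nat.le_of_dvd (by omega) h3)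
    · rintro rfl
      exact ⟨⟨hx, le_rfl⟩, dvd_rfl⟩
  rw [hfil, Finset.sum_singleton, abs_term]

theorem not_quadraticOmegaParityUniformInQ : ¬ QuadraticOmegaParityUniformInQ := by
  intro h
  obtain ⟨f, hf, hd, hl⟩ := hypotheses_inhabited
  obtain ⟨x₀, hx₀⟩ := h f hf hd hl (1 / 2) one_half_pos
  have hx1 : 1 ≤ max x₀ 1 := le_max_right _ _
  have hS := hx₀ (max x₀ 1) (le_max_left _ _) (max x₀ 1) 0 hx1
  rw [abs_S_self_modulus f hx1] at hS
  have hpos : (0 : ℝ) < ((max x₀ 1 : ℕ) : ℝ) := by exact_mod_cast hx1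
  rw [mul_div_assoc, div_self hpos.ne', mul_one] at hS
  linarith

/-! ## §3b The sign hypothesis is an encoding artefact: `toNat` versus `natAbs`

With `Int.natAbs` in place of `Int.toNat` the crux needs NO sign condition and is EQUIVALENT to the
filed one (`quadraticOmegaParity_iff_abs`). So `0 < f.leadingCoeff` is load-bearing (§1) only through
the encoding, exactly as claimed there. Ingredients: a quadratic with positive leading coefficient is
positive at every `n ≥ |c₀| + |c₁| + 1` (`eval_pos_of_le`), so the two encodings differ on a bounded
set of `n` and the two sums differ by `O(1)` (`abs_S_sub_Sabs_le`). -/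

/-- A polynomial of `natDegree 2` evaluated: `f(z) = c₀ + c₁ z + lc·z²`. -/
theorem eval_eq_of_natDegree_two {f : ℤ[X]} (hd : f.natDegree = 2) (z : ℤ) :
    f.eval z = f.coeff 0 + f.coeff 1 * z + f.leadingCoeff * z ^ 2 := by
  have hl : f.leadingCoeff = f.coeff 2 := by rw [leadingCoeff, hd]
  rw [eval_eq_sum_range, hd, hl]
  simp only [Finset.sum_range_succ, Finset.sum_range_zero, zero_add, pow_zero, mul_one, pow_one]

/-- The explicit positivity threshold `B(f) = |c₀| + |c₁| + 1`. -/
def posBound (f : ℤ[X]) : ℕ := (|f.coeff 0| + |f.coeff 1| + 1).toNat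

theorem posBound_cast (f : ℤ[X]) : (posBound f : ℤ) = |f.coeff 0| + |f.coeff 1| + 1 := by
  rw [posBound, Int.toNat_of_nonneg (by positivity)]

/-- A quadratic with positive leading coefficient is positive at every `n ≥ B(f)`. -/
theorem eval_pos_of_le {f : ℤ[X]} (hd : f.natDegree = 2) (hl : 0 < f.leadingCoeff) {n : ℕ}
    (hn : posBound f ≤ n) : 0 < f.eval (n : ℤ) := by
  rw [eval_eq_of_natDegree_two hd]
  have hn' : |f.coeff 0| + |f.coeff 1| + 1 ≤ (n : ℤ) := by rw [← posBound_cast]; exact_mod_cast hn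
  have hn0 : (0 : ℤ) ≤ n := by positivity
  have h0 := neg_abs_le (f.coeff 0)
  have h1 := neg_abs_le (f.coeff 1)
  have ha0 := abs_nonneg (f.coeff 0)
  have ha1 := abs_nonneg (f.coeff 1)
  have hl1 : (1 : ℤ) ≤ f.leadingCoeff := hl
  have hA : 0 ≤ (n : ℤ) * ((n : ℤ) - (|f.coeff 0| + |f.coeff 1| + 1)) := mul_nonneg hn0 (by linarith)
  have hL : (n : ℤ) ^ 2 ≤ f.leadingCoeff * (n : ℤ) ^ 2 := by nlinarith [sq_nonneg (n : ℤ)]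
  have hc1 : -(|f.coeff 1| * n) ≤ f.coeff 1 * n := by nlinarith
  nlinarith

/-- For `n ≥ B(f)` the two encodings of the value agree. -/
theorem toNat_eq_natAbs_of_le {f : ℤ[X]} (hd : f.natDegree = 2) (hl : 0 < f.leadingCoeff) {n : ℕ}
    (hn : posBound f ≤ n) : (f.eval (n : ℤ)).toNat = (f.eval (n : ℤ)).natAbs := by
  have h := (eval_pos_of_le hd hl hn).le
  have : ((f.eval (n : ℤ)).toNat : ℤ) = (f.eval (n : ℤ)).natAbs := by
    rw [Int.toNat_of_nonneg h, Int.natAbs_of_nonneg h]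
  exact_mod_cast this

/-- The `natAbs`-encoded AP parity sum. -/
noncomputable def Sabs (f : ℤ[X]) (q a x : ℕ) : ℝ :=
  ∑ n ∈ (Finset.Icc 1 x).filter (fun n : ℕ => n ≡ a [MOD q]),
    (-1 : ℝ) ^ ArithmeticFunction.cardDistinctFactors ((f.eval (n : ℤ)).natAbs)

/-- `natAbs`-encoded conclusion for one triple. -/
def ConclAbs (f : ℤ[X]) (q a : ℕ) : Prop :=
  (fun x : ℕ => Sabs f q a x) =o[atTop] fun x : ℕ => (x : ℝ)

theorem Sabs_neg (f : ℤ[X]) (q a x : ℕ) : Sabs (-f) q a x = Sabs f q a x := by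
  simp only [Sabs, eval_neg, Int.natAbs_neg]

theorem conclAbs_neg (f : ℤ[X]) (q a : ℕ) : ConclAbs (-f) q a ↔ ConclAbs f q a := by
  simp only [ConclAbs, Sabs_neg]

/-- The two encodings give sums differing by at most `2·B(f)`, uniformly in `q, a, x`. -/
theorem abs_S_sub_Sabs_le {f : ℤ[X]} (hd : f.natDegree = 2) (hl : 0 < f.leadingCoeff)
    (q a x : ℕ) : |S f q a x - Sabs f q a x| ≤ 2 * posBound f := by
  unfold S Sabs
  rw [← Finset.sum_sub_distrib]
  set F := (Finset.Icc 1 x).filter (fun n : ℕ => n ≡ a [MOD q]) with hF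
  set g : ℕ → ℝ := fun n => (-1 : ℝ) ^ ArithmeticFunction.cardDistinctFactors ((f.eval (n : ℤ)).toNat)
      - (-1 : ℝ) ^ ArithmeticFunction.cardDistinctFactors ((f.eval (n : ℤ)).natAbs) with hg
  have hzero : ∀ n ∈ F.filter (fun n : ℕ => ¬ n < posBound f), g n = 0 := by
    intro n hn
    rw [Finset.mem_filter, not_lt] at hn
    simp only [hg, toNat_eq_natAbs_of_le hd hl hn.2, sub_self]
  have hsplit := Finset.sum_filter_add_sum_filter_not F (fun n : ℕ => n < posBound f) g
  rw [Finset.sum_eq_zero hzero, add_zero] at hsplit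
  change |∑ n ∈ F, g n| ≤ _
  rw [← hsplit]
  refine (Finset.abs_sum_le_sum_abs _ _).trans ?_
  have hterm : ∀ n ∈ F.filter (fun n : ℕ => n < posBound f), |g n| ≤ 2 := by
    intro n _
    simp only [hg]
    refine (abs_sub _ _).trans ?_
    rw [abs_term, abs_term]
    norm_num
  refine (Finset.sum_le_sum hterm).trans ?_
  rw [sum_const, nsmul_eq_mul]
  have hcard : (F.filter (fun n : ℕ => n < posBound f)).card ≤ posBound f := by
    calc (F.filter (fun n : ℕ => n < posBound f)).card ≤ (Finset.range (posBound f)).card :=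
          Finset.card_le_card fun n hn => by
            rw [Finset.mem_filter] at hn; exact Finset.mem_range.mpr hn.2
      _ = posBound f := Finset.card_range _
  have : ((F.filter (fun n : ℕ => n < posBound f)).card : ℝ) ≤ posBound f := by exact_mod_cast hcard
  linarith

/-- A uniformly bounded difference does not affect `o(x)`. -/
theorem isLittleO_of_abs_sub_le {u v : ℕ → ℝ} {C : ℝ} (h : ∀ x, |u x - v x| ≤ C)
    (hv : v =o[atTop] fun x : ℕ => (x : ℝ)) : u =o[atTop] fun x : ℕ => (x : ℝ) := by
  have h1 : (fun x => u x - v x) =O[atTop] (fun _ : ℕ => (1 : ℝ)) :=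
    IsBigO.of_bound C (Eventually.of_forall fun x => by
      simpa only [Real.norm_eq_abs, abs_one, mul_one] using h x)
  have h2 : (fun _ : ℕ => (1 : ℝ)) =o[atTop] (fun x : ℕ => (x : ℝ)) := by
    rw [Asymptotics.isLittleO_one_left_iff]
    simpa only [Real.norm_natCast] using tendsto_natCast_atTop_atTop
  have h3 := (h1.trans_isLittleO h2).add hv
  simpa only [sub_add_cancel] using h3

/-- For positive leading coefficient the two encodings give equivalent conclusions. -/
theorem concl_iff_conclAbs {f : ℤ[X]} (hd : f.natDegree = 2) (hl : 0 < f.leadingCoeff) (q a : ℕ) :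
    Concl f q a ↔ ConclAbs f q a := by
  constructor
  · intro h
    refine isLittleO_of_abs_sub_le (C := 2 * posBound f) (fun x => ?_) h
    rw [abs_sub_comm]; exact abs_S_sub_Sabs_le hd hl q a x
  · intro h
    exact isLittleO_of_abs_sub_le (C := 2 * posBound f) (fun x => abs_S_sub_Sabs_le hd hl q a x) h

/-- The SIGN-FREE form of the crux: `natAbs` encoding, no condition on the leading coefficient. -/
def QuadraticOmegaParityAbs : Prop :=
  ∀ f : ℤ[X], Irreducible f → f.natDegree = 2 → ∀ q a : ℕ, 0 < q → ConclAbs f q a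

/-- **The crux is equivalent to its sign-free `natAbs` form.** (`→`: for `lc < 0` apply the crux
to `−f`, which is irreducible with `lc > 0`, and use `|f(n)| = |−f(n)|`; `lc = 0` is excluded since an
irreducible `f` is non-zero. `←`: immediate.) -/
theorem quadraticOmegaParity_iff_abs : QuadraticOmegaParity ↔ QuadraticOmegaParityAbs := by
  constructor
  · intro h f hf hd q a hq
    rcases lt_trichotomy 0 f.leadingCoeff with hl | hl | hl
    · exact (concl_iff_conclAbs hd hl q a).mp (h f hf hd hl q a hq)
    · exact absurd hl.symm (leadingCoeff_ne_zero.mpr hf.ne_zero)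
    · have hf' : Irreducible (-f) := ((Associated.refl f).neg_right).irreducible hf
      have hd' : (-f).natDegree = 2 := by rw [natDegree_neg, hd]
      have hl' : 0 < (-f).leadingCoeff := by rw [leadingCoeff_neg]; linarith
      have h1 := (concl_iff_conclAbs hd' hl' q a).mp (h (-f) hf' hd' hl' q a hq)
      rwa [conclAbs_neg] at h1
  · intro h f hf hd hl q a hq
    exact (concl_iff_conclAbs hd hl q a).mpr (h f hf hd q a hq)

/-! ## §3c Content: the crux is equivalent to its extension to imprimitive quadratics

`Irreducible f` in `ℤ[X]` forces content `1`. The natural wider class "`ℚ`-irreducible integer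
quadratics" = `{c · h : c ≥ 1, h primitive irreducible}` is NOT a source of counterexamples: along any
progression, `(−1)^{ω(c·h(n))} = ε · (−1)^{ω(h(n))}` with `ε` constant on classes modulo `q·c`
(`term_content_mul`), so the crux for `h` at modulus `q·c` gives the statement for `c·h` at modulus
`q` (`quadraticOmegaParity_iff_withContent`). This is the formal content of §1's remark on
`Irreducible` and one half of the "APs ⟺ content" reformulation of §4(iii). -/

/-- `ω n = #(primeFactors n)`. -/
theorem cardDistinctFactors_eq_card_primeFactors (n : ℕ) :
    ArithmeticFunction.cardDistinctFactors n = n.primeFactors.card := by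
  rw [ArithmeticFunction.cardDistinctFactors_apply, ← List.card_toFinset]; rfl

/-- Polynomial congruence: if `p ∣ m` and `n ≡ b (mod m)` then `p ∣ h(n) ↔ p ∣ h(b)`. -/
theorem dvd_eval_iff_of_modEq (h : ℤ[X]) {p m n b : ℕ} (hpm : p ∣ m) (hnb : n ≡ b [MOD m]) :
    (p : ℤ) ∣ h.eval (n : ℤ) ↔ (p : ℤ) ∣ h.eval (b : ℤ) := by
  have h1 : (m : ℤ) ∣ (b : ℤ) - n := Nat.modEq_iff_dvd.mp hnb
  have h2 : (p : ℤ) ∣ h.eval (b : ℤ) - h.eval (n : ℤ) :=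
    (Int.natCast_dvd_natCast.mpr hpm).trans (h1.trans (Polynomial.sub_dvd_eval_sub _ _ _))
  constructor
  · intro hn
    have := dvd_add hn h2
    rwa [add_sub_cancel] at this
  · intro hb
    have := dvd_sub hb h2
    rwa [sub_sub_cancel] at this

/-- The content sign on the class of `b`: `ε = (−1)^{#{p ∣ c prime : p ∤ h(b)}}`. -/
noncomputable def contentSign (c : ℕ) (h : ℤ[X]) (b : ℕ) : ℝ :=
  (-1 : ℝ) ^ (c.primeFactors.filter (fun p : ℕ => ¬ ((p : ℤ) ∣ h.eval (b : ℤ)))).card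

theorem abs_contentSign (c : ℕ) (h : ℤ[X]) (b : ℕ) : |contentSign c h b| = 1 := by
  rw [contentSign, abs_pow, abs_neg, abs_one, one_pow]

/-- **The multiplicative split of the term.** For `c ≥ 1`, `h(n) > 0` and `n ≡ b (mod m)` with
`c ∣ m`: `(−1)^{ω((c·h)(n))} = ε_b · (−1)^{ω(h(n))}`. -/
theorem term_content_mul {c : ℕ} (hc : c ≠ 0) (h : ℤ[X]) {m n b : ℕ} (hcm : c ∣ m)
    (hnb : n ≡ b [MOD m]) (hpos : 0 < h.eval (n : ℤ)) :
    (-1 : ℝ) ^ ArithmeticFunction.cardDistinctFactors (((C (c : ℤ) * h).eval (n : ℤ)).toNat)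
      = contentSign c h b *
        (-1 : ℝ) ^ ArithmeticFunction.cardDistinctFactors ((h.eval (n : ℤ)).toNat) := by
  set v : ℕ := (h.eval (n : ℤ)).toNat with hv
  have hvz : (v : ℤ) = h.eval (n : ℤ) := by rw [hv, Int.toNat_of_nonneg hpos.le]
  have hv0 : v ≠ 0 := by
    intro h0; rw [h0] at hvz; simp at hvz; linarith
  have hprod : (((C (c : ℤ) * h).eval (n : ℤ)).toNat) = c * v := by
    have : ((((C (c : ℤ) * h).eval (n : ℤ)).toNat : ℤ)) = ((c * v : ℕ) : ℤ) := by
      rw [Int.toNat_of_nonneg, eval_mul, eval_C, Nat.cast_mul, hvz]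
      rw [eval_mul, eval_C]; positivity
    exact_mod_cast this
  rw [hprod, cardDistinctFactors_eq_card_primeFactors, cardDistinctFactors_eq_card_primeFactors,
    Nat.primeFactors_mul hc hv0, ← Finset.card_sdiff_add_card, pow_add, contentSign]
  congr 3
  ext p
  simp only [Finset.mem_sdiff, Finset.mem_filter, Nat.mem_primeFactors]
  constructor
  · rintro ⟨⟨hp, hpc, -⟩, hnot⟩
    refine ⟨⟨hp, hpc, hc⟩, fun hb => hnot ⟨hp, ?_, hv0⟩⟩
    have : (p : ℤ) ∣ (v : ℤ) := hvz ▸ (dvd_eval_iff_of_modEq h (hpc.trans hcm) hnb).mpr hb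
    exact_mod_cast this
  · rintro ⟨⟨hp, hpc, -⟩, hnot⟩
    refine ⟨⟨hp, hpc, hc⟩, fun ⟨_, hpv, _⟩ => hnot ?_⟩
    have : (p : ℤ) ∣ (v : ℤ) := by exact_mod_cast hpv
    exact (dvd_eval_iff_of_modEq h (hpc.trans hcm) hnb).mp (hvz ▸ this)

/-- A sum of terms bounded by `2` and vanishing from `N` on is at most `2N` in absolute value. -/
theorem abs_sum_le_of_vanishing {φ : ℕ → ℝ} {N : ℕ} (F : Finset ℕ)
    (hzero : ∀ n, N ≤ n → φ n = 0) (hbd : ∀ n, |φ n| ≤ 2) : |∑ n ∈ F, φ n| ≤ 2 * N := by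
  have hsplit := Finset.sum_filter_add_sum_filter_not F (fun n : ℕ => n < N) φ
  rw [Finset.sum_eq_zero (fun n hn => hzero n (not_lt.mp (Finset.mem_filter.mp hn).2)),
    add_zero] at hsplit
  rw [← hsplit]
  refine (Finset.abs_sum_le_sum_abs _ _).trans ?_
  refine (Finset.sum_le_sum fun n _ => hbd n).trans ?_
  rw [sum_const, nsmul_eq_mul]
  have hcard : (F.filter (fun n : ℕ => n < N)).card ≤ N := by
    calc (F.filter (fun n : ℕ => n < N)).card ≤ (Finset.range N).card :=
          Finset.card_le_card fun n hn => by
            rw [Finset.mem_filter] at hn; exact Finset.mem_range.mpr hn.2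
      _ = N := Finset.card_range _
  have : ((F.filter (fun n : ℕ => n < N)).card : ℝ) ≤ N := by exact_mod_cast hcard
  linarith

/-- Per class modulo `q·c`: the sum for `c·h` is `ε_b ·` (the sum for `h`) up to `2B(h)`. -/
theorem abs_fiber_sub_le {c : ℕ} (hc : c ≠ 0) {h : ℤ[X]} (hd : h.natDegree = 2)
    (hl : 0 < h.leadingCoeff) (q b x : ℕ) :
    |S (C (c : ℤ) * h) (q * c) b x - contentSign c h b * S h (q * c) b x| ≤ 2 * posBound h := by
  unfold S
  rw [Finset.mul_sum, ← Finset.sum_sub_distrib]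
  set F := (Finset.Icc 1 x).filter (fun n : ℕ => n ≡ b [MOD q * c]) with hF
  have key : ∀ n ∈ F, posBound h ≤ n →
      (-1 : ℝ) ^ ArithmeticFunction.cardDistinctFactors (((C (c : ℤ) * h).eval (n : ℤ)).toNat)
        - contentSign c h b *
          (-1 : ℝ) ^ ArithmeticFunction.cardDistinctFactors ((h.eval (n : ℤ)).toNat) = 0 := by
    intro n hn hN
    rw [hF, Finset.mem_filter] at hn
    rw [term_content_mul hc h (dvd_mul_left c q) hn.2 (eval_pos_of_le hd hl hN), sub_self]
  set φ : ℕ → ℝ := fun n => if n ∈ F then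
      (-1 : ℝ) ^ ArithmeticFunction.cardDistinctFactors (((C (c : ℤ) * h).eval (n : ℤ)).toNat)
      - contentSign c h b *
        (-1 : ℝ) ^ ArithmeticFunction.cardDistinctFactors ((h.eval (n : ℤ)).toNat)
      else 0 with hφ
  have hrw : ∑ n ∈ F,
      ((-1 : ℝ) ^ ArithmeticFunction.cardDistinctFactors (((C (c : ℤ) * h).eval (n : ℤ)).toNat)
      - contentSign c h b *
        (-1 : ℝ) ^ ArithmeticFunction.cardDistinctFactors ((h.eval (n : ℤ)).toNat))
      = ∑ n ∈ F, φ n := Finset.sum_congr rfl fun n hn => by simp only [hφ, if_pos hn]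
  rw [hrw]
  refine abs_sum_le_of_vanishing F (fun n hN => ?_) (fun n => ?_)
  · simp only [hφ]
    split_ifs with hn
    · exact key n hn hN
    · rfl
  · simp only [hφ]
    split_ifs
    · refine (abs_sub _ _).trans ?_
      rw [abs_mul, abs_contentSign, one_mul, abs_term, abs_term]; norm_num
    · norm_num

/-- The fiber decomposition of the progression `n ≡ a (mod q)` into classes modulo `q·c`. -/
theorem S_eq_sum_fibers (g : ℤ[X]) {q c : ℕ} (hq : 0 < q) (hc : c ≠ 0) (a x : ℕ) :
    S g q a x =
      ∑ b ∈ (Finset.range (q * c)).filter (fun b : ℕ => b ≡ a [MOD q]), S g (q * c) b x := by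
  have hqc : 0 < q * c := Nat.mul_pos hq (Nat.pos_of_ne_zero hc)
  unfold S
  rw [← Finset.sum_fiberwise_of_maps_to (s := (Finset.Icc 1 x).filter (fun n : ℕ => n ≡ a [MOD q]))
    (t := (Finset.range (q * c)).filter (fun b : ℕ => b ≡ a [MOD q]))
    (g := fun n : ℕ => n % (q * c))]
  · refine Finset.sum_congr rfl fun b hb => ?_
    rw [Finset.mem_filter, Finset.mem_range] at hb
    refine Finset.sum_congr ?_ fun _ _ => rfl
    ext n
    simp only [Finset.mem_filter, Finset.mem_Icc]
    constructor
    · rintro ⟨⟨hn, -⟩, hmod⟩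
      refine ⟨hn, ?_⟩
      rw [Nat.ModEq, hmod, Nat.mod_eq_of_lt hb.1]
    · rintro ⟨hn, hmod⟩
      have hmod' : n % (q * c) = b := by rw [hmod, Nat.mod_eq_of_lt hb.1]
      have hna : n ≡ a [MOD q] :=
        (Nat.ModEq.of_mul_right c (Nat.mod_modEq n (q * c)).symm).trans (hmod'.symm ▸ hb.2)
      exact ⟨⟨hn, hna⟩, hmod'⟩
  · intro n hn
    rw [Finset.mem_filter] at hn
    rw [Finset.mem_filter, Finset.mem_range]
    exact ⟨Nat.mod_lt _ hqc, (Nat.ModEq.of_mul_right c (Nat.mod_modEq n (q * c))).trans hn.2⟩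

/-- The crux extended to all `ℚ`-irreducible integer quadratics `c · h` (content `c ≥ 1` allowed). -/
def QuadraticOmegaParityWithContent : Prop :=
  ∀ c : ℕ, c ≠ 0 → ∀ h : ℤ[X], Irreducible h → h.natDegree = 2 → 0 < h.leadingCoeff →
    ∀ q a : ℕ, 0 < q → Concl (C (c : ℤ) * h) q a

/-- **The crux is equivalent to its extension to imprimitive quadratics `c·h`.** -/
theorem quadraticOmegaParity_iff_withContent :
    QuadraticOmegaParity ↔ QuadraticOmegaParityWithContent := by
  constructor
  · intro hQ c hc h hh hd hl q a hq
    have hqc : 0 < q * c := Nat.mul_pos hq (Nat.pos_of_ne_zero hc)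
    unfold Concl
    simp_rw [S_eq_sum_fibers (C (c : ℤ) * h) hq hc a]
    refine IsLittleO.sum fun b _ => ?_
    have h1 : (fun x : ℕ => contentSign c h b * S h (q * c) b x) =o[atTop] fun x : ℕ => (x : ℝ) :=
      (hQ h hh hd hl (q * c) b hqc).const_mul_left _
    exact isLittleO_of_abs_sub_le (fun x => abs_fiber_sub_le hc hd hl q b x) h1
  · intro h f hf hd hl q a hq
    have := h 1 one_ne_zero f hf hd hl q a hq
    simp only [Nat.cast_one, C_1, one_mul] at this
    exact this

/-! ## §3d The progression aspect IS the content aspect: reduction to `q = 1`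

Substituting `n = q·m + a₀` (`a₀ = a mod q`) turns the progression sum for `f` into the FULL sum for
the dilated quadratic `g = f(qX + a₀)` up to one term (`abs_S_sub_S_dilate_le`); `g` is again
`ℚ`-irreducible of degree 2 with positive leading coefficient, i.e. `g = c·h` with `h` primitive
irreducible (`dilate_eq_content_mul`), but possibly `c > 1`. With §3c this proves the reformulation
announced in §4(iii): `quadraticOmegaParity_iff_contentQ1` — the crux is equivalent to the `q = 1`
statement over all `ℚ`-irreducible integer quadratics `c·h`. -/

/-- The index set of the substitution `n = q·m + a₀`. -/
theorem filter_modEq_eq_image (q a x : ℕ) :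
    (Finset.Icc 1 x).filter (fun n : ℕ => n ≡ a [MOD q]) =
      ((Finset.range (x + 1)).filter (fun m : ℕ => 1 ≤ q * m + a % q ∧ q * m + a % q ≤ x)).image
        (fun m : ℕ => q * m + a % q) := by
  ext n
  simp only [Finset.mem_filter, Finset.mem_Icc, Finset.mem_image, Finset.mem_range]
  constructor
  · rintro ⟨⟨h1, h2⟩, hmod⟩
    refine ⟨n / q, ⟨?_, ?_⟩, ?_⟩
    · exact Nat.lt_succ_of_le ((Nat.div_le_self n q).trans h2)
    · have : q * (n / q) + a % q = n := by rw [← hmod]; exact Nat.div_add_mod n q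
      rw [this]; exact ⟨h1, h2⟩
    · rw [← hmod]; exact Nat.div_add_mod n q
  · rintro ⟨m, ⟨-, hb1, hb2⟩, rfl⟩
    refine ⟨⟨hb1, hb2⟩, ?_⟩
    rw [Nat.ModEq, add_comm, Nat.add_mul_mod_self_left, Nat.mod_mod]

/-- The dilated polynomial evaluates as the original one along the progression. -/
theorem eval_dilate (f : ℤ[X]) (q a₀ m : ℕ) :
    (f.comp (C (q : ℤ) * X + C (a₀ : ℤ))).eval (m : ℤ) = f.eval ((q * m + a₀ : ℕ) : ℤ) := by
  rw [eval_comp, eval_add, eval_mul, eval_C, eval_X, eval_C]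
  push_cast
  ring_nf

/-- **Substitution**: `|S_f(x; q, a) − S_g(⌊(x − a₀)/q⌋; 1, 0)| ≤ 1` for `g = f(qX + a₀)`. -/
theorem abs_S_sub_S_dilate_le (f : ℤ[X]) {q : ℕ} (hq : 0 < q) (a x : ℕ) :
    |S f q a x - S (f.comp (C (q : ℤ) * X + C ((a % q : ℕ) : ℤ))) 1 0 ((x - a % q) / q)| ≤ 1 := by
  set a₀ := a % q with ha₀
  set Y := (x - a₀) / q with hY
  set g := f.comp (C (q : ℤ) * X + C (a₀ : ℤ)) with hg
  set t : ℕ → ℝ := fun m => (-1 : ℝ) ^ ArithmeticFunction.cardDistinctFactors ((g.eval (m : ℤ)).toNat)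
    with ht
  set M := (Finset.range (x + 1)).filter (fun m : ℕ => 1 ≤ q * m + a₀ ∧ q * m + a₀ ≤ x) with hM
  -- the progression sum, reindexed
  have hinj : Set.InjOn (fun m : ℕ => q * m + a₀) M := by
    intro m _ m' _ hmm
    have : q * m = q * m' := by simpa using hmm
    exact Nat.eq_of_mul_eq_mul_left hq this
  have hS1 : S f q a x = ∑ m ∈ M, t m := by
    unfold S
    rw [filter_modEq_eq_image q a x, Finset.sum_image hinj]
    refine Finset.sum_congr rfl fun m _ => ?_
    simp only [ht, hg, eval_dilate]
  have hS2 : S g 1 0 Y = ∑ m ∈ Finset.Icc 1 Y, t m := by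
    unfold S; rw [filter_modEq_one]
  -- `Icc 1 Y ⊆ M` and `M \ Icc 1 Y ⊆ {0}`
  have hsub : Finset.Icc 1 Y ⊆ M := by
    intro m hm
    rw [Finset.mem_Icc] at hm
    have h1 : q * m ≤ x - a₀ := by rw [mul_comm]; exact (Nat.le_div_iff_mul_le hq).mp hm.2
    have h2 : q ≤ q * m := Nat.le_mul_of_pos_right q hm.1
    have h5 : m ≤ q * m := Nat.le_mul_of_pos_left m hq
    have h3 : a₀ < x := Nat.lt_of_sub_pos (by omega)
    rw [hM, Finset.mem_filter, Finset.mem_range]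
    exact ⟨by omega, by omega, by omega⟩
  have hdiff : M \ Finset.Icc 1 Y ⊆ {0} := by
    intro m hm
    rw [Finset.mem_sdiff, hM, Finset.mem_filter, Finset.mem_Icc] at hm
    rw [Finset.mem_singleton]
    have hmY : m ≤ Y := (Nat.le_div_iff_mul_le hq).mpr (by rw [mul_comm]; omega)
    omega
  rw [hS1, hS2, ← Finset.sum_sdiff_eq_sub hsub]
  refine (Finset.abs_sum_le_sum_abs _ _).trans ?_
  simp only [ht, abs_term, sum_const, nsmul_eq_mul, mul_one]
  exact_mod_cast (Finset.card_le_card hdiff).trans (Finset.card_singleton 0).le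

/-- `⌊(x − a₀)/q⌋ → ∞`. -/
theorem tendsto_dilate_index (q a₀ : ℕ) (hq : 0 < q) :
    Tendsto (fun x : ℕ => (x - a₀) / q) atTop atTop := by
  refine tendsto_atTop_atTop.mpr fun b => ⟨q * b + a₀, fun x hx => ?_⟩
  exact (Nat.le_div_iff_mul_le hq).mpr (by rw [mul_comm]; omega)

/-- If the full sum for the dilated polynomial is `o(y)`, the progression sum for `f` is `o(x)`. -/
theorem concl_of_concl_dilate (f : ℤ[X]) {q : ℕ} (hq : 0 < q) (a : ℕ)
    (hg : Concl (f.comp (C (q : ℤ) * X + C ((a % q : ℕ) : ℤ))) 1 0) : Concl f q a := by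
  have h1 := hg.comp_tendsto (tendsto_dilate_index q (a % q) hq)
  have h2 : (fun x : ℕ => (((x - a % q) / q : ℕ) : ℝ)) =O[atTop] fun x : ℕ => (x : ℝ) :=
    IsBigO.of_bound 1 (Eventually.of_forall fun x => by
      rw [Real.norm_natCast, Real.norm_natCast, one_mul]
      exact_mod_cast (Nat.div_le_self _ _).trans (Nat.sub_le _ _))
  have h3 := h1.trans_isBigO h2
  exact isLittleO_of_abs_sub_le (C := 1) (fun x => abs_S_sub_S_dilate_le f hq a x) h3

/-- A degree-2 polynomial over `ℚ` composed with a non-constant linear one keeps "no roots". -/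
theorem roots_comp_linear_eq_zero {F : ℚ[X]} (hF : F.roots = 0) (hF0 : F ≠ 0) {u v : ℚ}
    (hu : u ≠ 0) : (F.comp (C u * X + C v)).roots = 0 := by
  by_contra hne
  obtain ⟨r, hr⟩ := Multiset.exists_mem_of_ne_zero hne
  have hG0 : F.comp (C u * X + C v) ≠ 0 := fun h0 => by
    have := congrArg natDegree h0
    rw [natDegree_comp, natDegree_linear hu, natDegree_zero, mul_one] at this
    rw [Polynomial.roots, dif_neg hF0] at hF
    -- natDegree F = 0 would contradict nothing directly; use: F ≠ 0 with F.comp L = 0 impossible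
    have h1 : F = 0 := by
      have hcomp : (F.comp (C u * X + C v)).comp (C u⁻¹ * (X - C v)) = F := by
        rw [comp_assoc]
        have : (C u * X + C v).comp (C u⁻¹ * (X - C v)) = X := by
          simp only [add_comp, mul_comp, C_comp, X_comp]
          rw [← mul_assoc, ← C_mul, mul_inv_cancel₀ hu, C_1, one_mul, sub_add_cancel]
        rw [this, comp_X]
      rw [← hcomp, h0, zero_comp]
    exact hF0 h1
  rw [mem_roots hG0, IsRoot, eval_comp] at hr
  have : (C u * X + C v).eval r ∈ F.roots := (mem_roots hF0).mpr hr
  rw [hF] at this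
  exact Multiset.notMem_zero _ this

/-- **The dilated quadratic is `c·h`** with `c ≥ 1` and `h` primitive irreducible of degree 2 with
positive leading coefficient. -/
theorem dilate_eq_content_mul {f : ℤ[X]} (hf : Irreducible f) (hd : f.natDegree = 2)
    (hl : 0 < f.leadingCoeff) {q : ℕ} (hq : 0 < q) (a₀ : ℕ) :
    ∃ c : ℕ, c ≠ 0 ∧ ∃ h : ℤ[X], Irreducible h ∧ h.natDegree = 2 ∧ 0 < h.leadingCoeff ∧
      f.comp (C (q : ℤ) * X + C (a₀ : ℤ)) = C (c : ℤ) * h := by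
  have hqz : (q : ℤ) ≠ 0 := by exact_mod_cast hq.ne'
  set g := f.comp (C (q : ℤ) * X + C (a₀ : ℤ)) with hg
  have hLd : (C (q : ℤ) * X + C (a₀ : ℤ)).natDegree = 1 := natDegree_linear hqz
  have hgd : g.natDegree = 2 := by rw [hg, natDegree_comp, hd, hLd]
  have hgl : g.leadingCoeff = f.leadingCoeff * (q : ℤ) ^ 2 := by
    rw [hg, leadingCoeff_comp (by rw [hLd]; exact one_ne_zero), leadingCoeff_linear hqz, hd]
  have hglpos : 0 < g.leadingCoeff := by rw [hgl]; positivity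
  have hg0 : g ≠ 0 := leadingCoeff_ne_zero.mp hglpos.ne'
  -- content and primitive part
  have hc0 : g.content ≠ 0 := fun h0 => hg0 (content_eq_zero_iff.mp h0)
  have hcnn : 0 ≤ g.content := Int.nonneg_of_normalize_eq_self normalize_content
  have hcpos : 0 < g.content := lt_of_le_of_ne hcnn (Ne.symm hc0)
  refine ⟨g.content.toNat, by omega, g.primPart, ?_, ?_, ?_, ?_⟩
  rotate_left
  · rw [natDegree_primPart, hgd]
  · have h1 : g.leadingCoeff = g.content * g.primPart.leadingCoeff := by
      conv_lhs => rw [g.eq_C_content_mul_primPart, leadingCoeff_mul, leadingCoeff_C]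
    rw [h1] at hglpos
    exact (mul_pos_iff_of_pos_left hcpos).mp hglpos
  · rw [Int.toNat_of_nonneg hcnn]; exact g.eq_C_content_mul_primPart
  -- irreducibility of the primitive part, via Gauss and "no rational roots"
  rw [Polynomial.IsPrimitive.Int.irreducible_iff_irreducible_map_cast (isPrimitive_primPart g)]
  have hfprim : f.IsPrimitive := hf.isPrimitive (by rw [hd]; exact two_ne_zero)
  have hF : Irreducible (f.map (Int.castRingHom ℚ)) :=
    (Polynomial.IsPrimitive.Int.irreducible_iff_irreducible_map_cast hfprim).mp hf
  have hFd : (f.map (Int.castRingHom ℚ)).natDegree = 2 := by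
    rw [natDegree_map_eq_of_injective (Int.castRingHom ℚ).injective_int, hd]
  have hF0 : f.map (Int.castRingHom ℚ) ≠ 0 := hF.ne_zero
  have hFroots : (f.map (Int.castRingHom ℚ)).roots = 0 :=
    (irreducible_iff_roots_eq_zero_of_degree_le_three (by rw [hFd]) (by rw [hFd]; norm_num)).mp hF
  have hqQ : ((q : ℤ) : ℚ) ≠ 0 := by exact_mod_cast hq.ne'
  have hGeq : g.map (Int.castRingHom ℚ) =
      (f.map (Int.castRingHom ℚ)).comp (C ((q : ℤ) : ℚ) * X + C ((a₀ : ℤ) : ℚ)) := by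
    rw [hg, map_comp, Polynomial.map_add, Polynomial.map_mul, map_C, map_X, map_C, eq_intCast,
      eq_intCast]
  have hGd : (g.map (Int.castRingHom ℚ)).natDegree = 2 := by
    rw [natDegree_map_eq_of_injective (Int.castRingHom ℚ).injective_int, hgd]
  have hGroots : (g.map (Int.castRingHom ℚ)).roots = 0 := by
    rw [hGeq]; exact roots_comp_linear_eq_zero hFroots hF0 hqQ
  have hG : Irreducible (g.map (Int.castRingHom ℚ)) :=
    (irreducible_iff_roots_eq_zero_of_degree_le_three (by rw [hGd]) (by rw [hGd]; norm_num)).mpr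
      hGroots
  have hGsplit : g.map (Int.castRingHom ℚ) =
      C ((g.content : ℤ) : ℚ) * (g.primPart).map (Int.castRingHom ℚ) := by
    conv_lhs => rw [g.eq_C_content_mul_primPart]
    rw [Polynomial.map_mul, map_C, eq_intCast]
  have hunit : IsUnit (C ((g.content : ℤ) : ℚ)) :=
    isUnit_C.mpr (isUnit_iff_ne_zero.mpr (by exact_mod_cast hc0))
  rw [hGsplit] at hG
  exact (associated_unit_mul_left _ _ hunit).irreducible hG

/-- The `q = 1` content form of the crux. -/
def QuadraticOmegaParityContentQ1 : Prop :=
  ∀ c : ℕ, c ≠ 0 → ∀ h : ℤ[X], Irreducible h → h.natDegree = 2 → 0 < h.leadingCoeff →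
    Concl (C (c : ℤ) * h) 1 0

/-- **APs ⟺ content.** The crux is equivalent to: for every `c ≥ 1` and every primitive irreducible
quadratic `h` with positive leading coefficient, `Σ_{m ≤ x} (−1)^{ω(c·h(m))} = o(x)` — no
progressions. -/
theorem quadraticOmegaParity_iff_contentQ1 : QuadraticOmegaParity ↔ QuadraticOmegaParityContentQ1 := by
  constructor
  · intro hQ c hc h hh hd hl
    exact (quadraticOmegaParity_iff_withContent.mp hQ) c hc h hh hd hl 1 0 one_pos
  · intro h1 f hf hd hl q a hq
    obtain ⟨c, hc, h, hh, hhd, hhl, hgh⟩ := dilate_eq_content_mul hf hd hl hq (a % q)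
    refine concl_of_concl_dilate f hq a ?_
    rw [hgh]
    exact h1 c hc h hh hhd hhl

/-- A `ℚ`-irreducible integer polynomial with positive leading coefficient is `c · h` with `c ≥ 1`
and `h` primitive irreducible (in `ℤ[X]`) with positive leading coefficient: content × primitive
part, Gauss's lemma. -/
theorem eq_content_mul_of_irreducible_map {g : ℤ[X]}
    (hG : Irreducible (g.map (Int.castRingHom ℚ))) (hl : 0 < g.leadingCoeff) :
    ∃ c : ℕ, c ≠ 0 ∧ ∃ h : ℤ[X], Irreducible h ∧ h.natDegree = g.natDegree ∧
      0 < h.leadingCoeff ∧ g = C (c : ℤ) * h := by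
  have hg0 : g ≠ 0 := leadingCoeff_ne_zero.mp hl.ne'
  have hc0 : g.content ≠ 0 := fun h0 => hg0 (content_eq_zero_iff.mp h0)
  have hcnn : 0 ≤ g.content := Int.nonneg_of_normalize_eq_self normalize_content
  have hcpos : 0 < g.content := lt_of_le_of_ne hcnn (Ne.symm hc0)
  refine ⟨g.content.toNat, by omega, g.primPart, ?_, natDegree_primPart g, ?_, ?_⟩
  · rw [Polynomial.IsPrimitive.Int.irreducible_iff_irreducible_map_cast (isPrimitive_primPart g)]
    have hGsplit : g.map (Int.castRingHom ℚ) =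
        C ((g.content : ℤ) : ℚ) * (g.primPart).map (Int.castRingHom ℚ) := by
      conv_lhs => rw [g.eq_C_content_mul_primPart]
      rw [Polynomial.map_mul, map_C, eq_intCast]
    have hunit : IsUnit (C ((g.content : ℤ) : ℚ)) :=
      isUnit_C.mpr (isUnit_iff_ne_zero.mpr (by exact_mod_cast hc0))
    rw [hGsplit] at hG
    exact (associated_unit_mul_left _ _ hunit).irreducible hG
  · have h1 : g.leadingCoeff = g.content * g.primPart.leadingCoeff := by
      conv_lhs => rw [g.eq_C_content_mul_primPart, leadingCoeff_mul, leadingCoeff_C]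
    rw [h1] at hl
    exact (mul_pos_iff_of_pos_left hcpos).mp hl
  · rw [Int.toNat_of_nonneg hcnn]; exact g.eq_C_content_mul_primPart

/-- Conversely `c · h` (`c ≥ 1`, `h` irreducible non-constant) is `ℚ`-irreducible. -/
theorem irreducible_map_C_mul {c : ℕ} (hc : c ≠ 0) {h : ℤ[X]} (hh : Irreducible h)
    (hd : h.natDegree ≠ 0) : Irreducible ((C (c : ℤ) * h).map (Int.castRingHom ℚ)) := by
  have hprim : h.IsPrimitive := hh.isPrimitive hd
  have hH : Irreducible (h.map (Int.castRingHom ℚ)) :=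
    (Polynomial.IsPrimitive.Int.irreducible_iff_irreducible_map_cast hprim).mp hh
  rw [Polynomial.map_mul, map_C, eq_intCast]
  have hunit : IsUnit (C ((c : ℤ) : ℚ)) :=
    isUnit_C.mpr (isUnit_iff_ne_zero.mpr (by exact_mod_cast hc))
  exact (associated_unit_mul_left _ _ hunit).symm.irreducible hH

/-- The cleanest form of the crux: polynomial Chowla (`ω`-form) at `q = 1` for ALL `ℚ`-irreducible
integer quadratics with positive leading coefficient (content allowed, no progressions). -/
def QuadraticOmegaParityRat : Prop :=
  ∀ g : ℤ[X], Irreducible (g.map (Int.castRingHom ℚ)) → g.natDegree = 2 → 0 < g.leadingCoeff →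
    Concl g 1 0

/-- **Crux ⟺ `q = 1` over `ℚ`-irreducible integer quadratics.** -/
theorem quadraticOmegaParity_iff_rat : QuadraticOmegaParity ↔ QuadraticOmegaParityRat := by
  rw [quadraticOmegaParity_iff_contentQ1]
  constructor
  · intro h1 g hG hd hl
    obtain ⟨c, hc, h, hh, hhd, hhl, hgh⟩ := eq_content_mul_of_irreducible_map hG hl
    rw [hgh]
    exact h1 c hc h hh (hhd.trans hd) hhl
  · intro hR c hc h hh hd hl
    have hcz : (c : ℤ) ≠ 0 := by exact_mod_cast hc
    refine hR (C (c : ℤ) * h) (irreducible_map_C_mul hc hh (by rw [hd]; exact two_ne_zero)) ?_ ?_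
    · rw [natDegree_C_mul hcz, hd]
    · rw [leadingCoeff_mul, leadingCoeff_C]; positivity

/-! ## §4 Why the crux resists (prose; the record behind the verdict)

(i) NO LOCAL OBSTRUCTION. Along `n ≡ a (mod q)` a prime `p ∣ q` divides `f(n)` either always or
never (it only flips the sign of the whole sum), and a prime `p ∤ q·lc(f)·disc(f)` divides `f(n)`
on `ρ_f(p) ∈ {0, 2}` classes mod `p`, independently of the class mod `q` (CRT). A bias of
`(−1)^{ω(f(n))}` detectable by congruences would need a set of primes of relative density one among
the `ρ_f(p) = 2` primes (the primes split in the splitting field `K_f`) all lying in ONE class of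
some ray-class character — impossible by Chebotarev (split primes equidistribute in every ray class
group of every other field; in `K_f` itself they are the trivial class, character value `+1`).
Genus/reciprocity constraints (e.g. for `f = X²+1`, `n ≡ 2 (mod 4)` forces an odd number of prime
factors `≡ 5 (mod 8)` counted with multiplicity) fix parities of SUB-counts over non-principal
classes only; the principal-class primes (density `> 0`) stay free. The independent-primes model
gives mean `∏_p (1 − 2ρ_f(p)/p) = 0` (the product diverges to `0` since `Σ ρ_f(p)/p = ∞`).

(ii) THE ONLY BIAS IN PRINT NEEDS INSEPARABILITY. `Literature.Barriers.Parity.FunctionFieldMobiusBias`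
(Conrad–Conrad–Gross 2008, Thm 4.8 / Ex. 6.10): over `κ[u]`, `μ(f(g))` is periodic in `g` when
`f ∈ κ[u][T^p]`, via Swan's formula `μ(h) = (−1)^{deg h} χ(disc h)`. Every `f ∈ ℤ[X]` is separable
and `ℤ` has no discriminant formula for `μ`/`ω`-parity ("no known analogue", CCG §2); the barrier's
own `scope_caveats` say it refutes only verbatim transfer. Even in characteristic 2 the separable-in-
disguise `T² + u` fits the naive prediction numerically (CCG §6). Nothing transfers to this crux.
SMALL-MODEL CHECK (this seat, `ff/ff_parity.py`, exact factorisation over `𝔽_q[u]`): for the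
separable quadratic pencil `f = X² + u`, `S_n := Σ_{deg g = n} (−1)^{ω(g² + u)}` satisfies
`S_n/#g = −.33, +.33, +.037, +.012, −.037, +.018, +.036, +.005, +.003` for `q = 3`, `n = 1…9`
(`#g = 2·3ⁿ ≤ 39366`) and `−.20, +.12, +.008, −.050, +.011, +.020` for `q = 5`, `n = 1…6`
(`#g ≤ 62500`), and `−.14, +.061, −.009, +.001, +.007` for `q = 7`, `n = 1…5` (`#g ≤ 100842`):
decaying, sign-changing, within the symmetry-corrected noise (the substitutions
`g ↦ d⁻¹·g(d²u)`, `d ∈ 𝔽_q^×` — including `g ↦ −g` — preserve `ω(g² + u)` and identify the values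
in orbits of size `q − 1`, so the coin-model σ is `√((q−1)·#g)`; the largest deviation,
`q = 5, n = 6`, is `2.5σ`, the next `1.7σ`). No CCG-type bias is visible for the separable pencil,
as CCG's Remark 6.3 predicts. (`f = X² + X + u` over `𝔽_3` gives IDENTICAL sums `S_n` for `n ≤ 8`:
completing the square, `g² + g + u = (g+2)² + (u − 1)` and `u ↦ u + 1` is an automorphism — a
consistency check of the code, and a reminder that over `𝔽_q`, `q` odd, every quadratic pencil is
`X² + (linear in u)` up to such substitutions.)

(iii) APs ⟺ CONTENT (PROVED in §3c–§3d: `quadraticOmegaParity_iff_withContent`,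
`quadraticOmegaParity_iff_contentQ1`). Substituting
`n = q·m + a₀` turns `S_f(x; q, a)` into `S_g(⌊(x−a₀)/q⌋; 1, 0) + O(1)` with `g = f(qX + a₀)`,
`ℚ`-irreducible of degree 2 with `lc(g) = lc(f)q² > 0` but possibly IMPRIMITIVE
(`f = X²+1, q = 2, a = 1`: `g = 2(2X²+2X+1)`). Conversely for `g = c·h`, `h` primitive,
`(−1)^{ω(c·h(m))} = (−1)^{ω(h(m))}·(−1)^{#{p ∣ c : p ∤ h(m)}}` and the second factor is periodic in
`m mod rad(c)`. Hence: QuadraticOmegaParity ⟺ [∀ g ∈ ℤ[X] with g.map ℚ irreducible, deg 2,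
lc > 0: Σ_{m ≤ x} (−1)^{ω(g(m))} = o(x)] — the progression structure is exactly the freedom to
allow content. (Informative for provers: the `q`-aspect carries no extra difficulty; for refuters:
a counterexample may be sought at `q = 1` among imprimitive quadratics — none exists by (i).)

(iv) NUMERICS (counterexample search). Other seats (item notes, 2026-08-15): exact `(−1)^{ω(f(n))}`
for 8 irreducible quadratics × 2576 progressions (`q ≤ 60`, all residues) to `x = 2·10⁶`:
`max |S|/#AP = 0.0169` (a 3.1σ event among 2576, as expected for noise), `q = 1`: `|S|/x ≤ 0.0014`;
`x = 2·10⁵` (two further seats): `max_a |S|/#AP ≤ 0.020` for `q ∈ {1,3,4,5,8,12}` over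
n²+1, n²+n+1, 2n²+1, n²−2, 3n²+3n+1, and `S/√#terms ∈ [−1.25, 0.9]` for a panel including
n²+n+41, n²+n+2, 2n²+1, n²+7 (q = 8), n²+4, n²+n+1 (q = 3) — square-root size, no drift. This seat: kit job j004865 (10 quadratics incl. the junk-
touching `n² − 2` and the fixed-divisor `n²+n+2`, all `(q ≤ 24, a)`, `x ≤ 10⁷`, sieve cross-checked
by trial division; summary + `outputs/summary.txt`, `ap_table.csv` auto-attach to the item) — still
QUEUED at the close of cycle 1 (2026-08-16T04:50Z, compute queue ≈ 2500 deep); its table reports,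
per `(f, q, a)`, `S(10⁷; q, a)/√M` and `max_x |S(x; q, a)|/√#terms` — anything beyond `|z| ≈ 4.5`
over the 3000 progressions, or a running-max ratio growing with `x`, would be the signal to chase.
A bias `c·x/q` would be visible at these ranges down to `c ≈ 2·10⁻³` (`q = 1`) … `10⁻²` (`q = 24`).

(v) STATUS IN PRINT (read at the page: Teräväinen, *On the Liouville function at polynomial
arguments*, Amer. J. Math. 2024, doi:10.1353/ajm.2024.a932436 = arXiv:2010.07924, §1 and §3.4).
Chowla (1965) conjectured `Σ_{n ≤ x} λ(P(n)) = o(x)` for every non-square `P` ((1.1) there); this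
strong form "is wide open for any polynomials with nonlinear irreducible factors" (§1, p. 2). Even the
weak form, Conj. 1.2 (= Cassaigne–Ferenczi–Mauduit–Rivat–Sárközy): `λ(P(n)) = v` infinitely often
for each sign `v`, is open for irreducible quadratics — Problem 3.1: "show that for every integer
`d ≠ 0` we have `λ(n²+d) = −1` for infinitely many `n`" (§3.4), with Borwein–Choi–Ganguli's criterion
(Canad. Math. Bull. 56 (2013) = arXiv:1109.3107, Thms 1–2: via Pell-type equations `f(n) = l m²`, one
sign change of `λ(f(n))` after an explicit `N_f` forces infinitely many; their p. 1: for degree `> 1`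
Chowla's conjecture "seems to be extremely hard and still remains wide open") the only general tool.
The `ω`-form filed here is of identical strength (`(−1)^ω` and `λ` differ by the multiplicities, a
squarefree-sieve away — cf. the route's `OmegaToMobiusAP`). TRUE for almost all polynomials in
coefficient boxes (Browning–Sofos–Teräväinen 2022, cited §2.2.3 there). For `f = X²+1` the sum is a
LINE SUM `Σ_{n ≤ x} (−1)^{ω_{ℤ[i]}(n+i)}` of a multiplicative function of `ℤ[i]` (one Gaussian prime
above each `p ≡ 1 (4)` dividing `n²+1`), a one-dimensional slice of density `X^{1/2}` of a
two-dimensional multiplicative sum — below every proved bilinear/Type-II range (Friedlander–Iwaniec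
`X²+Y⁴` has density `X^{3/4}`; Harman's `n^{4/5+ε}`-smooth values of `n²+1` with positive density,
quoted as Prop. 2.11 there, give no sign information). No negative result, numerical anomaly or
heuristic against the crux is recorded anywhere searched (`ledger negatives --problem Parity`:
2 unrelated refutations; barrier catalogue: only (ii) touches polynomial parity; `lit search` /
`lit galaxy` were degraded (rc 75 / queue-saturated) during cycle 1 — NOTES.md lists the queries to rerun).

(vi) WHAT WOULD KILL IT. Only a structural identity forcing `(−1)^{ω(f(n))}` on a positive-density
set of `n` in some class — excluded by (i) for congruence structure and by separability for
CCG structure. A refutation is therefore as hard as exhibiting a genuinely new bias phenomenon over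
`ℤ`; the seat's estimate: the crux is TRUE and open, `refuted-…` is not reachable, and the honest
label is `open-problem` (as the planner filed it).
-/

end Summit.Parity.BatemanHorn.Cruxes.QuadraticOmegaParity.Disproof
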